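import Summits.HodgeConjecture.HodgeConjecture.Theorems.Ring2HypothesesDescentMotivatedKunneth
import HarnessLib

/-!
# Ring 2 hypotheses, descent face — ANDRÉ'S `ᶜΛ = * L *` AS ONE MOTIVATED CLASS (Prop. 2.2 «Λ, ᶜΛ») and Kleiman's
# `Λ`-form of `B(X)` from the `⋆`-form: assembling per-degree correspondence classes along the Künneth projectors

research route conditional on HC_CM; not a corollary; Q11.4-sentence-2 already refuted in dim ≥ 3.
Cell `pub-hodge-ring2` (Hodge ladder STAGE 3), seat `ring2-b05` (binder row b05
`Ring2.Hypotheses.MotivatedImpliesAlgebraicAV`), gen 36. `HC_CM` (`Theses.RankFourFaces.CMAbelianHodge`) does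
not occur in this file; nothing here proves a case of the Hodge conjecture; rows b05 / b10 stay OPEN.

A homogeneous operator of degree `-2` on `H•(X(ℂ); ℂ)` such as André's `ᶜΛ = *_L ∘ L ∘ *_L` (§1.1, Prop. 1.2; Kleiman's
`Λ` up to the normalisation of `*`) is «given by a correspondence» when ONE class `λ ∈ H^{2(n-1)}((X ⊗ X)(ℂ))` induces it in
EVERY degree. Gen 36 gives, per degree, a motivated class inducing `*_η` there (`lefschetzInvolution_mem_map_corrAction`) and
the motivated Künneth projectors `π^a` as single classes (`exists_motivated_kunnethProjector`); this file assembles: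

* §1 `exists_class_of_perDegree_of_closed` — in a family `S` closed under uniform composition and containing the Künneth
  projectors, per-degree classes `v_a ∈ S e` glue to ONE class `V = Σ_a v_a ∘ π^a ∈ S e` with `[V]_* = [v_a]_*` on `Hᵃ` for
  every `a ≤ 2n`.
* §2 `exists_perDegree_starSandwich_of_closed` — in such a family containing moreover uniform Lefschetz powers and, for each
  degree, a class inducing `*_η`, there is for each `a` a class of codimension `n - 1` inducing `*_η ∘ L ∘ *_η` on `Hᵃ`.
* §3 **`exists_motivated_lambdaClass`** — for every smooth projective complex `X` of dimension `n = e + 1`, every polarisation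
  `η` and every orientation family: ONE motivated class `λ ∈ A_motᵉ(X ⊗ X)_ℂ` with `[λ]_* = *_η ∘ L_η ∘ *_η : Hᵃ → H^{a-2}` in
  every degree (André Prop. 2.2 for `ᶜΛ`); **`exists_algebraic_lambdaClass_of_standardConjectureBStar`** — under
  `StandardConjectureBStar n X η` the same with an ALGEBRAIC class (Kleiman: the `⋆`/`θ`-form of `B(X)` implies the `Λ`-form,
  on the real carriers, complex orientation family).

No definition, no named fact, no sorry. References: Andre1996Motifs (§1.1 p. 10, Prop. 1.2 p. 11, Prop. 2.2 p. 16),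
Kleiman1968AlgebraicCycles (§1.4 Prop. 1.4.4–1.4.6, §2 Prop. 2.3), Grothendieck1968 (§3 p. 196).
-/

noncomputable section

-- every declaration of this problem lives in `Summit.HodgeConjecture.HodgeConjecture.…` (summit = sub-problem)
set_option linter.dupNamespace false

open CategoryTheory AlgebraicGeometry MonoidalCategory CartesianMonoidalCategory
open Literature.AlgebraicTopology.SingularHomology Literature.Geometry.Kaehler
open Literature.AlgebraicGeometry Literature.AlgebraicGeometry.Motives
  Literature.AlgebraicGeometry.HodgeTheory

namespace Summit.HodgeConjecture.HodgeConjecture.Theorems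

variable (μ : OrientationFamily) {n : ℕ} {X : SchemeOver ℂ} {η : complexBetti X 2}

/-! ## §1 Gluing per-degree classes along the Künneth projectors -/

/-- **Gluing per-degree classes.** In a family `S e ⊆ H^{2e}((X ⊗ X)(ℂ))` of subspaces closed under uniform composition
(`hcomp`) and containing the Künneth projectors (`hK`: for each `a` ONE class of codimension `n` acting as `id` on `Hᵃ` and `0`
elsewhere), classes `v_a ∈ S e` (one for each degree) glue to ONE class `V ∈ S e` with `[V]_* = [v_a]_*` on `Hᵃ(X(ℂ))` for all
`a ≤ 2n`: `V = Σ_{a ≤ 2n} v_a ∘ π^a`. [cite: Kleiman1968AlgebraicCycles, §1.4 Prop. 1.4.4] [cite: Andre1996Motifs, Prop. 2.2 (p. 16)] -/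
theorem exists_class_of_perDegree_of_closed (hX : IsSmoothProjective n X)
    (S : (e : ℕ) → Submodule ℂ (complexBetti (X ⊗ X) (2 * e)))
    (hcomp : ∀ {e e' e'' : ℕ} (_ : e + e' = e'' + n) {γ : complexBetti (X ⊗ X) (2 * e)}
      {γ' : complexBetti (X ⊗ X) (2 * e')}, γ ∈ S e → γ' ∈ S e' →
      ∃ γ'' ∈ S e'', ∀ {a a₁ a₂ : ℕ} (h₁ : a + 2 * e' = a₁ + 2 * n) (h₂ : a₁ + 2 * e = a₂ + 2 * n)
        (h₃ : a + 2 * e'' = a₂ + 2 * n),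
        corrAction μ hX hX h₃ γ'' = corrAction μ hX hX h₂ γ ∘ₗ corrAction μ hX hX h₁ γ')
    (hK : ∀ a : ℕ, ∃ π ∈ S n, ∀ a' : ℕ, corrAction μ hX hX (rfl : a' + 2 * n = a' + 2 * n) π =
      if a' = a then LinearMap.id else 0)
    {e : ℕ} (v : ℕ → complexBetti (X ⊗ X) (2 * e)) (hv : ∀ a, v a ∈ S e) :
    ∃ V ∈ S e, ∀ (a : ℕ) (_ : a ≤ 2 * n) (b : ℕ) (hab : a + 2 * e = b + 2 * n),
      corrAction μ hX hX hab V = corrAction μ hX hX hab (v a) := by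
  classical
  choose π hπS hπ using hK
  choose w hwS hw using fun a ↦ hcomp (e := e) (e' := n) (e'' := e) rfl (hv a) (hπS a)
  refine ⟨∑ a ∈ Finset.range (2 * n + 1), w a, Submodule.sum_mem _ fun a _ ↦ hwS a, fun a ha b hab ↦ ?_⟩
  rw [map_sum, Finset.sum_eq_single_of_mem a (Finset.mem_range.mpr (by omega))]
  · rw [hw a rfl hab hab, hπ a a, if_pos rfl, LinearMap.comp_id]
  · intro a' _ hne
    rw [hw a' rfl hab hab, hπ a' a, if_neg (Ne.symm hne), LinearMap.comp_zero]

/-! ## §2 Per-degree `* L *` sandwiches as classes -/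

/-- **A class inducing `*_η ∘ L_η ∘ *_η` on one degree.** In a family `S` closed under uniform composition, containing the
uniform Lefschetz power `[L]` (`hΛ₁`, codimension `n + 1`) and, for each degree `a` with `a + c = 2n`, a class of codimension
`c` inducing `*_η : Hᵃ → Hᶜ` (`hstar`): for `a + c = 2n`, `c + 2 + b = 2n` (so `b = a - 2`) there is a class of codimension
`e`, `e + 1 = n`, inducing `*_η ∘ L ∘ *_η : Hᵃ → Hᶜ → H^{c+2} → Hᵇ` on `Hᵃ` (composite of codimensions `c`, `n + 1`, `b`).
[cite: Andre1996Motifs, §1.1 (p. 10) and Prop. 2.2 (p. 16)] -/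
theorem exists_perDegree_starSandwich_of_closed (hX : IsSmoothProjective n X) (hL : HasHardLefschetzProperty η n)
    (S : (e : ℕ) → Submodule ℂ (complexBetti (X ⊗ X) (2 * e)))
    (hcomp : ∀ {e e' e'' : ℕ} (_ : e + e' = e'' + n) {γ : complexBetti (X ⊗ X) (2 * e)}
      {γ' : complexBetti (X ⊗ X) (2 * e')}, γ ∈ S e → γ' ∈ S e' →
      ∃ γ'' ∈ S e'', ∀ {a a₁ a₂ : ℕ} (h₁ : a + 2 * e' = a₁ + 2 * n) (h₂ : a₁ + 2 * e = a₂ + 2 * n)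
        (h₃ : a + 2 * e'' = a₂ + 2 * n),
        corrAction μ hX hX h₃ γ'' = corrAction μ hX hX h₂ γ ∘ₗ corrAction μ hX hX h₁ γ')
    (hΛ₁ : ∃ Λ ∈ S (n + 1), ∀ {a₁ a₂ : ℕ} (h12 : a₁ + 2 * 1 = a₂) (h : a₁ + 2 * (n + 1) = a₂ + 2 * n),
      corrAction μ hX hX h Λ = lefschetzPowTo η 1 a₁ a₂ h12)
    (hstar : ∀ (a c : ℕ) (hc : a + c = 2 * n), ∃ u ∈ S c, ∀ (h : a + 2 * c = c + 2 * n),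
      corrAction μ hX hX h u = lefschetzInvolution hL hc)
    {e a b c : ℕ} (he : e + 1 = n) (hc : a + c = 2 * n) (hb : c + 2 + b = 2 * n) :
    ∃ v ∈ S e, ∀ (hab : a + 2 * e = b + 2 * n),
      corrAction μ hX hX hab v = lefschetzInvolution hL hb ∘ₗ lefschetzPowTo η 1 c (c + 2) rfl ∘ₗ
        lefschetzInvolution hL hc := by
  obtain ⟨u₀, hu₀S, hu₀⟩ := hstar a c hc
  obtain ⟨u₂, hu₂S, hu₂⟩ := hstar (c + 2) b hb
  obtain ⟨Λ, hΛS, hΛ⟩ := hΛ₁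
  obtain ⟨γ₁, hγ₁S, hγ₁⟩ := hcomp (e := n + 1) (e' := c) (e'' := c + 1) (by omega) hΛS hu₀S
  obtain ⟨v, hvS, hv⟩ := hcomp (e := b) (e' := c + 1) (e'' := e) (by omega) hu₂S hγ₁S
  refine ⟨v, hvS, fun hab ↦ ?_⟩
  rw [hv (a₁ := c + 2) (by omega) (by omega) hab, hγ₁ (a₁ := c) (by omega) (by omega) (by omega), hu₂ (by omega),
    hΛ (show c + 2 * 1 = c + 2 by omega) (by omega), hu₀ (by omega)]

/-! ## §3 `ᶜΛ` as ONE motivated class; the `Λ`-form of `B(X)` from the `⋆`-form -/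

/-- **André Prop. 2.2 for `ᶜΛ = *_L L *_L`, as ONE motivated class.** For `X` smooth projective of dimension `n = e + 1` over
`ℂ`, a polarisation class `η` and any orientation family `μ`, there is a MOTIVATED class `λ ∈ A_motᵉ(X ⊗ X)_ℂ` whose action on
EVERY degree is `*_η ∘ L_η ∘ *_η`: for all `a + c = 2n`, `c + 2 + b = 2n` (i.e. `b = a - 2`) and the degree equation
`a + 2e = b + 2n`, `[λ]_* = *_η ∘ L ∘ *_η : Hᵃ → Hᶜ → H^{c+2} → Hᵇ`. Per degree the sandwich is a uniform composite of motivated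
classes (§2 with `S = A_mot(X ⊗ X)`); the per-degree classes glue along the motivated Künneth projectors (§1).
[cite: Andre1996Motifs, Prop. 2.2 (p. 16) and Prop. 1.2 (p. 11)] [cite: Kleiman1968AlgebraicCycles, §1.4 Prop. 1.4.4–1.4.6] -/
theorem exists_motivated_lambdaClass (hX : IsSmoothProjective n X) (hη : IsPolarizationClass n X η) {e : ℕ}
    (he : e + 1 = n) :
    ∃ lam ∈ motivatedClasses (n + n) (X ⊗ X) e, ∀ (a b c : ℕ) (hc : a + c = 2 * n) (hb : c + 2 + b = 2 * n)
      (hab : a + 2 * e = b + 2 * n),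
      corrAction μ hX hX hab lam = lefschetzInvolution hη.hasHardLefschetz hb ∘ₗ lefschetzPowTo η 1 c (c + 2) rfl ∘ₗ
        lefschetzInvolution hη.hasHardLefschetz hc := by
  have hL : HasHardLefschetzProperty η n := hη.hasHardLefschetz
  have hXX : IsSmoothProjective (n + n) (X ⊗ X) := IsSmoothProjective.tensor_holds hX hX
  have hΘ := isPolarizationClass_boxSum hX hX hη hη
  -- the closure data of `S = A_mot(X ⊗ X)`
  have hcomp : ∀ {e e' e'' : ℕ} (_ : e + e' = e'' + n) {γ : complexBetti (X ⊗ X) (2 * e)}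
      {γ' : complexBetti (X ⊗ X) (2 * e')}, γ ∈ motivatedClasses (n + n) (X ⊗ X) e →
      γ' ∈ motivatedClasses (n + n) (X ⊗ X) e' →
      ∃ γ'' ∈ motivatedClasses (n + n) (X ⊗ X) e'', ∀ {a a₁ a₂ : ℕ} (h₁ : a + 2 * e' = a₁ + 2 * n)
        (h₂ : a₁ + 2 * e = a₂ + 2 * n) (h₃ : a + 2 * e'' = a₂ + 2 * n),
        corrAction μ hX hX h₃ γ'' = corrAction μ hX hX h₂ γ ∘ₗ corrAction μ hX hX h₁ γ' := by
    intro e e' e'' he' γ γ' hγ hγ'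
    obtain ⟨γ'', hmot, -, hact⟩ := exists_corrCompClass_total μ hX hX hX he' γ γ'
    exact ⟨γ'', hmot hγ hγ', hact⟩
  have hδalg := (corrAction_diagonalClass μ hX 0).1
  have hδmot : _ ∈ motivatedClasses (n + n) (X ⊗ X) n :=
    algebraicClasses_le_motivatedClasses_of_isPolarizationClass hXX hΘ n hδalg
  have hΛ₁ : ∃ Λ ∈ motivatedClasses (n + n) (X ⊗ X) (n + 1), ∀ {a₁ a₂ : ℕ} (h12 : a₁ + 2 * 1 = a₂)
      (h : a₁ + 2 * (n + 1) = a₂ + 2 * n), corrAction μ hX hX h Λ = lefschetzPowTo η 1 a₁ a₂ h12 := by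
    obtain ⟨Λ, hmot, -, hact⟩ := exists_twistClass_total μ hX hX hη.mem_algebraicClasses 1 (rfl : n + 1 = n + 1)
      (complexGysin μ hX (IsSmoothProjective.tensor_holds hX hX) (lift (𝟙 X) (𝟙 X))
        (show 0 + 2 * (n + n) = 2 * n + 2 * n by omega) (singularCohomology.one ℂ (ComplexPoints X)))
    refine ⟨Λ, hmot hδmot, fun h12 h ↦ ?_⟩
    rw [hact h12 rfl h, (corrAction_diagonalClass μ hX _).2, LinearMap.id_comp]
  have hstar : ∀ (a c : ℕ) (hc : a + c = 2 * n), ∃ u ∈ motivatedClasses (n + n) (X ⊗ X) c,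
      ∀ (h : a + 2 * c = c + 2 * n), corrAction μ hX hX h u = lefschetzInvolution hL hc := by
    intro a c hc
    obtain ⟨u, hu, hact⟩ := lefschetzInvolution_mem_map_corrAction μ hX hη hc
    exact ⟨u, hu, fun h ↦ hact⟩
  -- per-degree sandwiches, then glue
  have hper : ∀ a : ℕ, ∃ v ∈ motivatedClasses (n + n) (X ⊗ X) e, ∀ (b c : ℕ) (hc : a + c = 2 * n)
      (hb : c + 2 + b = 2 * n) (hab : a + 2 * e = b + 2 * n),
      corrAction μ hX hX hab v = lefschetzInvolution hL hb ∘ₗ lefschetzPowTo η 1 c (c + 2) rfl ∘ₗ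
        lefschetzInvolution hL hc := by
    intro a
    by_cases ha : 2 ≤ a ∧ a ≤ 2 * n
    · obtain ⟨c, hc⟩ : ∃ c, a + c = 2 * n := ⟨2 * n - a, by omega⟩
      obtain ⟨b, hb⟩ : ∃ b, c + 2 + b = 2 * n := ⟨a - 2, by omega⟩
      obtain ⟨v, hvS, hv⟩ := exists_perDegree_starSandwich_of_closed μ hX hL
        (fun e ↦ motivatedClasses (n + n) (X ⊗ X) e) hcomp hΛ₁ hstar he hc hb
      refine ⟨v, hvS, fun b' c' hc' hb' hab ↦ ?_⟩
      obtain rfl : c' = c := by omega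
      obtain rfl : b' = b := by omega
      exact hv hab
    · refine ⟨0, Submodule.zero_mem _, fun b c hc hb hab ↦ ?_⟩
      exfalso
      omega
  choose v hvS hv using hper
  obtain ⟨V, hVS, hV⟩ := exists_class_of_perDegree_of_closed μ hX (fun e ↦ motivatedClasses (n + n) (X ⊗ X) e) hcomp
    (exists_motivated_kunnethProjector μ hX) v hvS
  refine ⟨V, hVS, fun a b c hc hb hab ↦ ?_⟩
  rw [hV a (by omega) b hab, hv a b c hc hb hab]

/-- **Kleiman: the `⋆`-form of `B(X)` gives the `Λ`-form** — under `StandardConjectureBStar n X η` (André's `*_η` an algebraic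
correspondence in every degree) there is ONE ALGEBRAIC class `λ ∈ Nᵉ H^{2e}((X ⊗ X)(ℂ))`, `e + 1 = n`, inducing
`ᶜΛ = *_η ∘ L_η ∘ *_η` in every degree (complex orientation family): the algebraic Künneth projectors of
`exists_algebraic_kunnethProjector_of_standardConjectureBStar` (`B ⟹ C`) glue the per-degree algebraic sandwiches.
[cite: Kleiman1968AlgebraicCycles, §1.4 Prop. 1.4.4–1.4.6 and §2 Prop. 2.3] [cite: Grothendieck1968, §3 p. 196 (B(X))] -/
theorem exists_algebraic_lambdaClass_of_standardConjectureBStar (hX : IsSmoothProjective n X)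
    (hη : IsPolarizationClass n X η) (hB : StandardConjectureBStar n X η) {e : ℕ} (he : e + 1 = n) :
    ∃ lam ∈ algebraicClasses (X ⊗ X) e, ∀ (a b c : ℕ) (hc : a + c = 2 * n) (hb : c + 2 + b = 2 * n)
      (hab : a + 2 * e = b + 2 * n),
      corrAction complexOrientationFamily hX hX hab lam =
        lefschetzInvolution hη.hasHardLefschetz hb ∘ₗ lefschetzPowTo η 1 c (c + 2) rfl ∘ₗ
          lefschetzInvolution hη.hasHardLefschetz hc := by
  have hL : HasHardLefschetzProperty η n := hη.hasHardLefschetz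
  have hXX : IsSmoothProjective (n + n) (X ⊗ X) := IsSmoothProjective.tensor_holds hX hX
  have hcomp : ∀ {e e' e'' : ℕ} (_ : e + e' = e'' + n) {γ : complexBetti (X ⊗ X) (2 * e)}
      {γ' : complexBetti (X ⊗ X) (2 * e')}, γ ∈ algebraicClasses (X ⊗ X) e → γ' ∈ algebraicClasses (X ⊗ X) e' →
      ∃ γ'' ∈ algebraicClasses (X ⊗ X) e'', ∀ {a a₁ a₂ : ℕ} (h₁ : a + 2 * e' = a₁ + 2 * n)
        (h₂ : a₁ + 2 * e = a₂ + 2 * n) (h₃ : a + 2 * e'' = a₂ + 2 * n),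
        corrAction complexOrientationFamily hX hX h₃ γ'' =
          corrAction complexOrientationFamily hX hX h₂ γ ∘ₗ corrAction complexOrientationFamily hX hX h₁ γ' := by
    intro e e' e'' he' γ γ' hγ hγ'
    obtain ⟨γ'', -, halg, hact⟩ := exists_corrCompClass_total complexOrientationFamily hX hX hX he' γ γ'
    exact ⟨γ'', halg hγ hγ', hact⟩
  have hδalg := (corrAction_diagonalClass complexOrientationFamily hX 0).1
  have hΛ₁ : ∃ Λ ∈ algebraicClasses (X ⊗ X) (n + 1), ∀ {a₁ a₂ : ℕ} (h12 : a₁ + 2 * 1 = a₂)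
      (h : a₁ + 2 * (n + 1) = a₂ + 2 * n), corrAction complexOrientationFamily hX hX h Λ = lefschetzPowTo η 1 a₁ a₂ h12 := by
    obtain ⟨Λ, -, halg, hact⟩ := exists_twistClass_total complexOrientationFamily hX hX hη.mem_algebraicClasses 1
      (rfl : n + 1 = n + 1)
      (complexGysin complexOrientationFamily hX (IsSmoothProjective.tensor_holds hX hX) (lift (𝟙 X) (𝟙 X))
        (show 0 + 2 * (n + n) = 2 * n + 2 * n by omega) (singularCohomology.one ℂ (ComplexPoints X)))
    refine ⟨Λ, halg hδalg, fun h12 h ↦ ?_⟩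
    rw [hact h12 rfl h, (corrAction_diagonalClass complexOrientationFamily hX _).2, LinearMap.id_comp]
  have hstar : ∀ (a c : ℕ) (hc : a + c = 2 * n), ∃ u ∈ algebraicClasses (X ⊗ X) c,
      ∀ (h : a + 2 * c = c + 2 * n), corrAction complexOrientationFamily hX hX h u = lefschetzInvolution hL hc := by
    intro a c hc
    obtain ⟨e₀, hab, u, hu, hact⟩ := Ring2.AbelianAll.IsAlgebraicCorrespondence.exists_eq_corrAction hX hX (hB hη a c hc)
    obtain rfl : e₀ = c := by omega
    exact ⟨u, hu, fun h ↦ hact.symm⟩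
  have hper : ∀ a : ℕ, ∃ v ∈ algebraicClasses (X ⊗ X) e, ∀ (b c : ℕ) (hc : a + c = 2 * n)
      (hb : c + 2 + b = 2 * n) (hab : a + 2 * e = b + 2 * n),
      corrAction complexOrientationFamily hX hX hab v = lefschetzInvolution hL hb ∘ₗ lefschetzPowTo η 1 c (c + 2) rfl ∘ₗ
        lefschetzInvolution hL hc := by
    intro a
    by_cases ha : 2 ≤ a ∧ a ≤ 2 * n
    · obtain ⟨c, hc⟩ : ∃ c, a + c = 2 * n := ⟨2 * n - a, by omega⟩
      obtain ⟨b, hb⟩ : ∃ b, c + 2 + b = 2 * n := ⟨a - 2, by omega⟩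
      obtain ⟨v, hvS, hv⟩ := exists_perDegree_starSandwich_of_closed complexOrientationFamily hX hL
        (fun e ↦ algebraicClasses (X ⊗ X) e) hcomp hΛ₁ hstar he hc hb
      refine ⟨v, hvS, fun b' c' hc' hb' hab ↦ ?_⟩
      obtain rfl : c' = c := by omega
      obtain rfl : b' = b := by omega
      exact hv hab
    · refine ⟨0, Submodule.zero_mem _, fun b c hc hb hab ↦ ?_⟩
      exfalso
      omega
  choose v hvS hv using hper
  obtain ⟨V, hVS, hV⟩ := exists_class_of_perDegree_of_closed complexOrientationFamily hX
    (fun e ↦ algebraicClasses (X ⊗ X) e) hcomp (exists_algebraic_kunnethProjector_of_standardConjectureBStar hX hη hB) v hvS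
  refine ⟨V, hVS, fun a b c hc hb hab ↦ ?_⟩
  rw [hV a (by omega) b hab, hv a b c hc hb hab]

end Summit.HodgeConjecture.HodgeConjecture.Theorems

end
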